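import Literature.NumberTheory.QuadraticFields.ThreeTorsionMeanProgressionCount
import HarnessLib

/-!
# Counting fundamental discriminants in a progression: positive discriminants, corollaries

Continuation of `ThreeTorsionMeanProgressionCount.lean` (theorems only): the real-quadratic (positive
discriminant) count `|#{D ∈ posFundDiscrs X : D ≡ a (mod m)} - (3/(π² m)) Π_{p ∣ m} (1 - p⁻²)⁻¹ X|
≤ 18 √X` for `m` odd, `gcd(a, m) = 1`, `X ≥ 1`; the versions under the hypothesis `(6a, m) = 1` of
`Literature.NumberTheory.QuadraticFields.tt_threeTorsion_sum_progression` (Taniguchi–Thorne 2013,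
Thm 6), whose main term `(3 + C^±)/(π² m) Π_{p ∣ m} (1 - p⁻²)⁻¹ X` is `Σ_{D ≡ a} 1 · (mean of #Cl₃)`
with exactly this `Σ_{D ≡ a} 1`. (The unrestricted counts `#negFundDiscrs X`, `#posFundDiscrs X`
`= (3/π²) X + O(√X)` are `abs_card_negFundDiscrs_sub_le`, `abs_card_posFundDiscrs_sub_le` of
`ThreeTorsionMeanProofs.lean`.)

## References
* T. Taniguchi, F. Thorne, *Secondary terms in counting functions for cubic fields*, Duke Math. J.
  162 (2013), Thm 6, §6.1 eq. (6.1), Lemma 21 [TaniguchiThorne2013].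
-/

noncomputable section

open Finset
open scoped ArithmeticFunction.Moebius

namespace Literature.NumberTheory.QuadraticFields

/-! ### Positive fundamental discriminants in a progression: decomposition -/

/-- The set `{D ∈ posFundDiscrs X : D ≡ a (mod m)}` split by 2-adic type (type I `2 ≤ D < X`,
`D ≡ c₁ (mod 4m)` squarefree; type II `D = 4d`, `1 ≤ d ≤ (X-1)/4`, `d ≡ c₂ (mod 4m)` squarefree;
type III `D = 8k`, `1 ≤ k ≤ (X-1)/8`, `k ≡ c₃ (mod 2m)` squarefree). [folklore] -/
theorem posFundDiscrs_filter_modEq_eq {m : ℕ} {a c₁ c₂ c₃ : ℤ} (X : ℕ)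
    (h₁ : ∀ x : ℤ, x ≡ c₁ [ZMOD ((4 * m : ℕ) : ℤ)] ↔ (x ≡ 1 [ZMOD (4 : ℕ)] ∧ 1 * x ≡ a [ZMOD m]))
    (h₂ : ∀ x : ℤ, x ≡ c₂ [ZMOD ((4 * m : ℕ) : ℤ)] ↔ (x ≡ 3 [ZMOD (4 : ℕ)] ∧ 4 * x ≡ a [ZMOD m]))
    (h₃ : ∀ x : ℤ, x ≡ c₃ [ZMOD ((2 * m : ℕ) : ℤ)] ↔ (x ≡ 1 [ZMOD (2 : ℕ)] ∧ 8 * x ≡ a [ZMOD m])) :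
    (posFundDiscrs X).filter (fun D => D ≡ a [ZMOD m]) =
      (Ico (2 : ℤ) X).filter (fun x => x ≡ c₁ [ZMOD ((4 * m : ℕ) : ℤ)] ∧ Squarefree x) ∪
      ((((Ico (1 : ℤ) (((X : ℤ) - 1) / 4 + 1)).filter
          (fun x => x ≡ c₂ [ZMOD ((4 * m : ℕ) : ℤ)] ∧ Squarefree x)).image (fun d => 4 * d)) ∪
       (((Ico (1 : ℤ) (((X : ℤ) - 1) / 8 + 1)).filter
          (fun x => x ≡ c₃ [ZMOD ((2 * m : ℕ) : ℤ)] ∧ Squarefree x)).image (fun k => 8 * k))) := by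
  ext D
  simp only [Finset.mem_union, Finset.mem_filter, Finset.mem_image, Finset.mem_Ico,
    mem_posFundDiscrs, fundDiscr_cond_iff, h₁, h₂, h₃]
  simp only [Nat.cast_ofNat, one_mul, Int.ModEq, Int.reduceMod]
  constructor
  · rintro ⟨⟨⟨hlo, hhi⟩, hcases⟩, hmod⟩
    rcases hcases with ⟨hD4, hsq, hne⟩ | ⟨d, rfl, hd3, hsq⟩ | ⟨k, rfl, hk, hsq⟩
    · exact Or.inl ⟨⟨by omega, hhi⟩, ⟨hD4, hmod⟩, hsq⟩
    · exact Or.inr (Or.inl ⟨d, ⟨⟨by omega, by omega⟩, ⟨hd3, hmod⟩, hsq⟩, rfl⟩)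
    · exact Or.inr (Or.inr ⟨k, ⟨⟨by omega, by omega⟩, ⟨hk, hmod⟩, hsq⟩, rfl⟩)
  · rintro (⟨⟨hlo, hhi⟩, ⟨hD4, hmod⟩, hsq⟩ | ⟨d, ⟨⟨hlo, hhi⟩, ⟨hd3, hmod⟩, hsq⟩, rfl⟩ |
        ⟨k, ⟨⟨hlo, hhi⟩, ⟨hk, hmod⟩, hsq⟩, rfl⟩)
    · exact ⟨⟨⟨by omega, hhi⟩, Or.inl ⟨hD4, hsq, by omega⟩⟩, hmod⟩
    · exact ⟨⟨⟨by omega, by omega⟩, Or.inr (Or.inl ⟨d, rfl, hd3, hsq⟩)⟩, hmod⟩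
    · exact ⟨⟨⟨by omega, by omega⟩, Or.inr (Or.inr ⟨k, rfl, hk, hsq⟩)⟩, hmod⟩

/-- The cardinality version of `posFundDiscrs_filter_modEq_eq`. [folklore] -/
theorem card_posFundDiscrs_filter_modEq_eq {m : ℕ} {a c₁ c₂ c₃ : ℤ} (X : ℕ)
    (h₁ : ∀ x : ℤ, x ≡ c₁ [ZMOD ((4 * m : ℕ) : ℤ)] ↔ (x ≡ 1 [ZMOD (4 : ℕ)] ∧ 1 * x ≡ a [ZMOD m]))
    (h₂ : ∀ x : ℤ, x ≡ c₂ [ZMOD ((4 * m : ℕ) : ℤ)] ↔ (x ≡ 3 [ZMOD (4 : ℕ)] ∧ 4 * x ≡ a [ZMOD m]))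
    (h₃ : ∀ x : ℤ, x ≡ c₃ [ZMOD ((2 * m : ℕ) : ℤ)] ↔ (x ≡ 1 [ZMOD (2 : ℕ)] ∧ 8 * x ≡ a [ZMOD m])) :
    ((posFundDiscrs X).filter (fun D => D ≡ a [ZMOD m])).card =
      ((Ico (2 : ℤ) X).filter (fun x => x ≡ c₁ [ZMOD ((4 * m : ℕ) : ℤ)] ∧ Squarefree x)).card +
      ((Ico (1 : ℤ) (((X : ℤ) - 1) / 4 + 1)).filter
          (fun x => x ≡ c₂ [ZMOD ((4 * m : ℕ) : ℤ)] ∧ Squarefree x)).card +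
      ((Ico (1 : ℤ) (((X : ℤ) - 1) / 8 + 1)).filter
          (fun x => x ≡ c₃ [ZMOD ((2 * m : ℕ) : ℤ)] ∧ Squarefree x)).card := by
  rw [posFundDiscrs_filter_modEq_eq X h₁ h₂ h₃]
  have hmem₁ : ∀ D ∈ (Ico (2 : ℤ) X).filter
      (fun x => x ≡ c₁ [ZMOD ((4 * m : ℕ) : ℤ)] ∧ Squarefree x), D % 4 = 1 := by
    intro D hD
    rw [Finset.mem_filter, h₁] at hD
    have := hD.2.1.1
    simp only [Nat.cast_ofNat, Int.ModEq, Int.reduceMod] at this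
    exact this
  have hmem₂ : ∀ D ∈ ((Ico (1 : ℤ) (((X : ℤ) - 1) / 4 + 1)).filter
      (fun x => x ≡ c₂ [ZMOD ((4 * m : ℕ) : ℤ)] ∧ Squarefree x)).image (fun d => 4 * d),
      D % 16 = 12 := by
    intro D hD
    rw [Finset.mem_image] at hD
    obtain ⟨d, hd, rfl⟩ := hD
    rw [Finset.mem_filter, h₂] at hd
    have := hd.2.1.1
    simp only [Nat.cast_ofNat, Int.ModEq, Int.reduceMod] at this
    omega
  have hmem₃ : ∀ D ∈ ((Ico (1 : ℤ) (((X : ℤ) - 1) / 8 + 1)).filter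
      (fun x => x ≡ c₃ [ZMOD ((2 * m : ℕ) : ℤ)] ∧ Squarefree x)).image (fun k => 8 * k),
      D % 16 = 8 := by
    intro D hD
    rw [Finset.mem_image] at hD
    obtain ⟨k, hk, rfl⟩ := hD
    rw [Finset.mem_filter, h₃] at hk
    have := hk.2.1.1
    simp only [Nat.cast_ofNat, Int.ModEq, Int.reduceMod] at this
    omega
  have hdisj₂₃ : Disjoint
      (((Ico (1 : ℤ) (((X : ℤ) - 1) / 4 + 1)).filter
          (fun x => x ≡ c₂ [ZMOD ((4 * m : ℕ) : ℤ)] ∧ Squarefree x)).image (fun d => 4 * d))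
      (((Ico (1 : ℤ) (((X : ℤ) - 1) / 8 + 1)).filter
          (fun x => x ≡ c₃ [ZMOD ((2 * m : ℕ) : ℤ)] ∧ Squarefree x)).image (fun k => 8 * k)) := by
    rw [Finset.disjoint_left]
    intro D hD hD'
    have h2 := hmem₂ D hD
    have h3 := hmem₃ D hD'
    omega
  have hdisj₁ : Disjoint
      ((Ico (2 : ℤ) X).filter (fun x => x ≡ c₁ [ZMOD ((4 * m : ℕ) : ℤ)] ∧ Squarefree x))
      ((((Ico (1 : ℤ) (((X : ℤ) - 1) / 4 + 1)).filter
          (fun x => x ≡ c₂ [ZMOD ((4 * m : ℕ) : ℤ)] ∧ Squarefree x)).image (fun d => 4 * d)) ∪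
       (((Ico (1 : ℤ) (((X : ℤ) - 1) / 8 + 1)).filter
          (fun x => x ≡ c₃ [ZMOD ((2 * m : ℕ) : ℤ)] ∧ Squarefree x)).image (fun k => 8 * k))) := by
    rw [Finset.disjoint_left]
    intro D hD hD'
    have h1 := hmem₁ D hD
    rcases Finset.mem_union.1 hD' with h | h
    · have h2 := hmem₂ D h; omega
    · have h3 := hmem₃ D h; omega
  rw [Finset.card_union_of_disjoint hdisj₁, Finset.card_union_of_disjoint hdisj₂₃,
    Finset.card_image_of_injective _ (mul_right_injective₀ (by norm_num : (4 : ℤ) ≠ 0)),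
    Finset.card_image_of_injective _ (mul_right_injective₀ (by norm_num : (8 : ℤ) ≠ 0)),
    Nat.add_assoc]

/-! ### Positive fundamental discriminants in a progression: the count -/

/-- **Positive fundamental discriminants in a progression.** For `m` odd, `gcd(a, m) = 1` and
`X ≥ 1`: `|#{D ∈ posFundDiscrs X : D ≡ a (mod m)} - (3/(π² m)) Π_{p ∣ m} (1 - p⁻²)⁻¹ · X| ≤ 18 √X`
(the number of real quadratic fields with `Disc < X` and `Disc ≡ a (mod m)`; cf. Taniguchi–Thorne,
Lemma 21 and §6.1). [cite: TaniguchiThorne2013, Lemma 21 and §6.1] -/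
theorem abs_card_posFundDiscrs_filter_modEq_sub_le {m : ℕ} (hm : Odd m) {a : ℤ}
    (ha : Int.gcd a m = 1) {X : ℕ} (hX : 1 ≤ X) :
    |((((posFundDiscrs X).filter (fun D => D ≡ a [ZMOD m])).card : ℕ) : ℝ)
        - 3 / (Real.pi ^ 2 * m) * (∏ p ∈ m.primeFactors, (1 - 1 / (p : ℝ) ^ 2)⁻¹) * X|
      ≤ 18 * Real.sqrt X := by
  have hm0 : m ≠ 0 := fun h => by simp [h] at hm
  have hmR : (1 : ℝ) ≤ m := by exact_mod_cast Nat.pos_of_ne_zero hm0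
  have hsq1 : 1 ≤ Real.sqrt X := by
    rw [← Real.sqrt_one]; exact Real.sqrt_le_sqrt (by exact_mod_cast hX)
  -- the densities
  have hg₄ : 6 / Real.pi ^ 2 * ∏ p ∈ (4 * m).primeFactors, (1 - 1 / (p : ℝ) ^ 2)⁻¹ =
      8 / Real.pi ^ 2 * ∏ p ∈ m.primeFactors, (1 - 1 / (p : ℝ) ^ 2)⁻¹ := by
    rw [show 4 * m = 2 ^ 2 * m by norm_num, prod_primeFactors_two_pow_mul hm two_ne_zero]; ring
  have hg₂ : 6 / Real.pi ^ 2 * ∏ p ∈ (2 * m).primeFactors, (1 - 1 / (p : ℝ) ^ 2)⁻¹ =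
      8 / Real.pi ^ 2 * ∏ p ∈ m.primeFactors, (1 - 1 / (p : ℝ) ^ 2)⁻¹ := by
    rw [show 2 * m = 2 ^ 1 * m by norm_num, prod_primeFactors_two_pow_mul hm one_ne_zero]; ring
  have hgle : 8 / Real.pi ^ 2 * ∏ p ∈ m.primeFactors, (1 - 1 / (p : ℝ) ^ 2)⁻¹ ≤ 2 := by
    rw [← hg₂]; exact density_le_two (by omega)
  have hg0 : 0 ≤ 8 / Real.pi ^ 2 * ∏ p ∈ m.primeFactors, (1 - 1 / (p : ℝ) ^ 2)⁻¹ := by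
    rw [← hg₂]; exact density_nonneg _
  -- the degenerate case `X = 1`
  rcases eq_or_lt_of_le hX with hX1 | hX2
  · subst hX1
    have hempty : (posFundDiscrs 1).filter (fun D => D ≡ a [ZMOD m]) = ∅ := by
      refine Finset.filter_eq_empty_iff.2 fun D hD _ => ?_
      rw [mem_posFundDiscrs] at hD
      omega
    rw [hempty, Finset.card_empty, Nat.cast_zero, zero_sub, abs_neg, Nat.cast_one, mul_one,
      Real.sqrt_one, mul_one]
    set g := 8 / Real.pi ^ 2 * ∏ p ∈ m.primeFactors, (1 - 1 / (p : ℝ) ^ 2)⁻¹ with hg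
    have key : 3 / (Real.pi ^ 2 * m) * (∏ p ∈ m.primeFactors, (1 - 1 / (p : ℝ) ^ 2)⁻¹) =
        3 / 8 * (g / m) := by
      rw [hg]; ring
    rw [key, abs_of_nonneg (by positivity)]
    have : g / m ≤ 2 := by rw [div_le_iff₀ (by positivity)]; nlinarith
    linarith
  -- now `X ≥ 2`
  have hX2' : (2 : ℤ) ≤ X := by exact_mod_cast hX2
  have ha' : IsCoprime a m := Int.isCoprime_iff_gcd_eq_one.2 ha
  have h2m : Nat.Coprime 2 m := Nat.coprime_two_left.2 hm
  have h4m : Nat.Coprime 4 m := by simpa using h2m.pow_left 2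
  have h8m : IsCoprime (8 : ℤ) m := by
    have := Nat.isCoprime_iff_coprime.2 (h2m.pow_left 3); simpa using this
  have h4m' : IsCoprime (4 : ℤ) m := by
    have := Nat.isCoprime_iff_coprime.2 h4m; simpa using this
  obtain ⟨c₁, hc₁, h₁⟩ := exists_residue_modEq_iff h4m (r := 1) (s := 1) isCoprime_one_left
    isCoprime_one_left ha'
  obtain ⟨c₂, hc₂, h₂⟩ := exists_residue_modEq_iff h4m (r := 3) (s := 4)
    ⟨-1, 1, by norm_num⟩ h4m' ha'
  obtain ⟨c₃, hc₃, h₃⟩ := exists_residue_modEq_iff h2m (r := 1) (s := 8) isCoprime_one_left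
    h8m ha'
  have hcard := card_posFundDiscrs_filter_modEq_eq X h₁ h₂ h₃
  set n₄ : ℤ := ((X : ℤ) - 1) / 4 with hn₄
  set n₈ : ℤ := ((X : ℤ) - 1) / 8 with hn₈
  have hn₄b : 4 * n₄ ≤ (X : ℤ) - 1 ∧ (X : ℤ) - 1 < 4 * n₄ + 4 := by omega
  have hn₈b : 8 * n₈ ≤ (X : ℤ) - 1 ∧ (X : ℤ) - 1 < 8 * n₈ + 8 := by omega
  have hL4 : 0 < 4 * m := by omega
  have hL2 : 0 < 2 * m := by omega
  have e₁ := abs_card_squarefree_modEq_sub_le hL4 hc₁ (a := 2) (b := (X : ℤ)) hX2'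
    (Or.inr two_pos) (M := X) (by omega) (by simp)
  have e₂ := abs_card_squarefree_modEq_sub_le hL4 hc₂ (a := 1) (b := n₄ + 1) (by omega)
    (Or.inr one_pos) (M := X) (by omega) (by omega)
  have e₃ := abs_card_squarefree_modEq_sub_le hL2 hc₃ (a := 1) (b := n₈ + 1) (by omega)
    (Or.inr one_pos) (M := X) (by omega) (by omega)
  rw [hg₄] at e₁ e₂
  rw [hg₂] at e₃
  set g := 8 / Real.pi ^ 2 * ∏ p ∈ m.primeFactors, (1 - 1 / (p : ℝ) ^ 2)⁻¹ with hg
  rw [hcard]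
  push_cast at e₁ e₂ e₃ ⊢
  have hn₄r : 4 * (n₄ : ℝ) ≤ (X : ℝ) - 1 ∧ (X : ℝ) - 1 < 4 * (n₄ : ℝ) + 4 := by
    constructor <;> exact_mod_cast (by omega : _)
  have hn₈r : 8 * (n₈ : ℝ) ≤ (X : ℝ) - 1 ∧ (X : ℝ) - 1 < 8 * (n₈ : ℝ) + 8 := by
    constructor <;> exact_mod_cast (by omega : _)
  rw [show (n₄ : ℝ) + 1 - 1 = n₄ by ring] at e₂
  rw [show (n₈ : ℝ) + 1 - 1 = n₈ by ring] at e₃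
  have key : ((((Ico (2 : ℤ) X).filter
        (fun x => x ≡ c₁ [ZMOD 4 * (m : ℤ)] ∧ Squarefree x)).card : ℕ) : ℝ)
      + ((((Ico (1 : ℤ) (n₄ + 1)).filter
          (fun x => x ≡ c₂ [ZMOD 4 * (m : ℤ)] ∧ Squarefree x)).card : ℕ) : ℝ)
      + ((((Ico (1 : ℤ) (n₈ + 1)).filter
          (fun x => x ≡ c₃ [ZMOD 2 * (m : ℤ)] ∧ Squarefree x)).card : ℕ) : ℝ)
      - 3 / (Real.pi ^ 2 * m) * (∏ p ∈ m.primeFactors, (1 - 1 / (p : ℝ) ^ 2)⁻¹) * X =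
      (((((Ico (2 : ℤ) X).filter
          (fun x => x ≡ c₁ [ZMOD 4 * (m : ℤ)] ∧ Squarefree x)).card : ℕ) : ℝ)
        - ((X : ℝ) - 2) / (4 * m) * g)
      + (((((Ico (1 : ℤ) (n₄ + 1)).filter
          (fun x => x ≡ c₂ [ZMOD 4 * (m : ℤ)] ∧ Squarefree x)).card : ℕ) : ℝ)
        - (n₄ : ℝ) / (4 * m) * g)
      + (((((Ico (1 : ℤ) (n₈ + 1)).filter
          (fun x => x ≡ c₃ [ZMOD 2 * (m : ℤ)] ∧ Squarefree x)).card : ℕ) : ℝ)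
        - (n₈ : ℝ) / (2 * m) * g)
      + g / (4 * m) * (((X : ℝ) - 2) + n₄ + 2 * n₈ - 3 / 2 * X) := by
    rw [hg]; ring
  rw [key]
  have hlast : |g / (4 * m) * (((X : ℝ) - 2) + n₄ + 2 * n₈ - 3 / 2 * X)| ≤ 3 := by
    rw [abs_mul, abs_of_nonneg (by positivity : 0 ≤ g / (4 * m))]
    have h1 : |((X : ℝ) - 2) + n₄ + 2 * n₈ - 3 / 2 * X| ≤ 6 := by
      rw [abs_le]; constructor <;> linarith [hn₄r.1, hn₄r.2, hn₈r.1, hn₈r.2]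
    have h2 : g / (4 * m) ≤ 1 / 2 := by
      rw [div_le_iff₀ (by positivity)]; linarith
    calc g / (4 * m) * |((X : ℝ) - 2) + n₄ + 2 * n₈ - 3 / 2 * X| ≤ 1 / 2 * 6 :=
        mul_le_mul h2 h1 (abs_nonneg _) (by norm_num)
      _ = 3 := by norm_num
  obtain ⟨l1, u1⟩ := abs_le.1 e₁
  obtain ⟨l2, u2⟩ := abs_le.1 e₂
  obtain ⟨l3, u3⟩ := abs_le.1 e₃
  obtain ⟨l4, u4⟩ := abs_le.1 hlast
  rw [abs_le]; constructor <;> linarith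

/-! ### Under the hypothesis `(6a, m) = 1` of Taniguchi–Thorne, Thm 6 -/

/-- `gcd(6a, m) = 1` implies `m` odd and `gcd(a, m) = 1`. [folklore] -/
theorem odd_and_gcd_eq_one_of_gcd_six_mul {m : ℕ} {a : ℤ} (h : Int.gcd (6 * a) m = 1) :
    Odd m ∧ Int.gcd a m = 1 := by
  have h6a : IsCoprime (6 * a) (m : ℤ) := Int.isCoprime_iff_gcd_eq_one.2 h
  refine ⟨?_, Int.isCoprime_iff_gcd_eq_one.1 h6a.of_mul_left_right⟩
  have h6 : IsCoprime (6 : ℤ) m := h6a.of_mul_left_left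
  have h2 : IsCoprime ((2 : ℕ) : ℤ) (m : ℤ) :=
    IsCoprime.of_isCoprime_of_dvd_left h6 ⟨3, by norm_num⟩
  exact Nat.coprime_two_left.1 (Nat.isCoprime_iff_coprime.1 h2)

/-- **The `Σ 1` part of Taniguchi–Thorne, Thm 6, imaginary side**: for `(6a, m) = 1` and `X ≥ 1`,
`|#{D ∈ negFundDiscrs X : D ≡ a (mod m)} - (3/(π² m)) Π_{p ∣ m} (1 - p⁻²)⁻¹ X| ≤ 18 √X`.
[cite: TaniguchiThorne2013, §6.1 eq. (6.1) and §6.6] -/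
theorem abs_card_negFundDiscrs_filter_modEq_sub_le_of_gcd_six_mul {m : ℕ} {a : ℤ}
    (h : Int.gcd (6 * a) m = 1) {X : ℕ} (hX : 1 ≤ X) :
    |((((negFundDiscrs X).filter (fun D => D ≡ a [ZMOD m])).card : ℕ) : ℝ)
        - 3 / (Real.pi ^ 2 * m) * (∏ p ∈ m.primeFactors, (1 - 1 / (p : ℝ) ^ 2)⁻¹) * X|
      ≤ 18 * Real.sqrt X :=
  abs_card_negFundDiscrs_filter_modEq_sub_le (odd_and_gcd_eq_one_of_gcd_six_mul h).1
    (odd_and_gcd_eq_one_of_gcd_six_mul h).2 hX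

/-- **The `Σ 1` part of Taniguchi–Thorne, Thm 6, real side**: for `(6a, m) = 1` and `X ≥ 1`,
`|#{D ∈ posFundDiscrs X : D ≡ a (mod m)} - (3/(π² m)) Π_{p ∣ m} (1 - p⁻²)⁻¹ X| ≤ 18 √X`.
[cite: TaniguchiThorne2013, §6.1 eq. (6.1) and §6.6] -/
theorem abs_card_posFundDiscrs_filter_modEq_sub_le_of_gcd_six_mul {m : ℕ} {a : ℤ}
    (h : Int.gcd (6 * a) m = 1) {X : ℕ} (hX : 1 ≤ X) :
    |((((posFundDiscrs X).filter (fun D => D ≡ a [ZMOD m])).card : ℕ) : ℝ)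
        - 3 / (Real.pi ^ 2 * m) * (∏ p ∈ m.primeFactors, (1 - 1 / (p : ℝ) ^ 2)⁻¹) * X|
      ≤ 18 * Real.sqrt X :=
  abs_card_posFundDiscrs_filter_modEq_sub_le (odd_and_gcd_eq_one_of_gcd_six_mul h).1
    (odd_and_gcd_eq_one_of_gcd_six_mul h).2 hX

end Literature.NumberTheory.QuadraticFields

end
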